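import Literature.Geometry.Riemannian.SphericalCylinderSmallScaleDominationProofs
import Mathlib
import HarnessLib

/-!
# Small-scale certificate for the conformal kernel domination (stub `stub_certSmall`)

Helper for the line `conformal-kernel-domination` of the crux
`Summit.SmoothPoincare4.SmoothPoincare4.Theses.CylinderEntropy.SliceIsolation` (crux item
stmt-SmoothPoincare4-7632).  In the normalised variables `T = t/‖y‖² > 0`, `u = z₅ − log ‖y‖`,
`s = ⟨z', ŷ⟩ ∈ [−1, 1]` the Jacobian-weighted pulled-back Euclidean Gaussian kernel times `V = 8π²/3` is
`pulled(T,u,s) = (8π²/3)·((4πT)²)⁻¹·exp(4u)·exp(−(exp(2u) − 2·exp(u)·s + 1)/(4T))`.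
We prove the SMALL-SCALE certificate: for `0 < T ≤ 10⁻⁵` ONE broadened on-axis cylinder ("zonal") kernel
`w · 𝔥(τ, s) · exp(−u²/(4τ))` at the matched centre `σ = 0` and scale `τ = (1+κ)T` plus an area atom `c`
dominate `pulled(T,·,·)` on `ℝ × [−1,1]`, with total mass `w + c ≤ 147/100`.

Constants: `ε = 1/25`, `κ = 9/100`, `c = 1/20`, `w = e^{4ε}(1+κ)²` (`≤ 1.1856 · 1.1881 ≤ 1.409`).
Writing `Q = (eᵘ − 1)² + 2eᵘ(1 − s) = e^{2u} − 2eᵘ s + 1`: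
* near region `Q ≤ ε²`: the tree's `SphericalCylinderConformal.near_exp_compare` gives
  `e^{4u} e^{−Q/4T} ≤ e^{4ε} e^{−(arccos(s)² + u²)/(4τ)}`, and the Cheeger–Yau minorant
  (`CheegerYauZonalSphereFour_holds`) `(8π²/3)(4πτ)⁻² e^{−arccos(s)²/4τ} ≤ 𝔥(τ, s)` together with
  `(4πτ)² = (1+κ)²(4πT)²` gives the atom;
* far region `Q > ε²`: `pulled ≤ c`, since `(8π²/3)(4πT)⁻² = 1/(6T²)` and either `eᵘ ≤ 2`, where
  `16 e^{−ε²/4T}/(6T²) ≤ 1/20` by `x¹⁶/16! ≤ eˣ` at `x = 1/(2500T) ≥ 40`, or `eᵘ > 2`, where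
  `Q ≥ e^{2u}/4` and `y³/6 ≤ eʸ` give `pulled ≤ 1024 T`.
-/

noncomputable section

-- the registered namespace `Summit.SmoothPoincare4.SmoothPoincare4.Theorems…` repeats a component
set_option linter.dupNamespace false

namespace Summit.SmoothPoincare4.SmoothPoincare4.Theorems.CylinderEntropySliceIsolation

open Literature.Geometry.Riemannian Literature.Geometry.Riemannian.SphericalCylinderEntropy
open Literature.Geometry.Riemannian.SphericalCylinderConformal (near_exp_compare)

/-- The total mass of the small-scale certificate: `e^{4/25} (109/100)² + 1/20 ≤ 147/100`
(`e^{4/25} ≤ 1 + 4/25 + (4/25)²`). [folklore] -/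
theorem certSmall_mass : Real.exp (4 / 25) * (109 / 100) ^ 2 + 1 / 20 ≤ 147 / 100 := by
  have hx : |(4 / 25 : ℝ)| ≤ 1 := by rw [abs_le]; constructor <;> norm_num
  have he := Real.abs_exp_sub_one_sub_id_le hx
  have he' : Real.exp (4 / 25) ≤ 1 + 4 / 25 + (4 / 25) ^ 2 := by
    have := (abs_le.1 he).2
    linarith
  nlinarith [he']

/-- For `x ≥ 40`, `(10⁹/3) x² ≤ eˣ` (from `x¹⁶/16! ≤ eˣ` and `40¹⁴ ≥ 16! · 10⁹/3`). [folklore] -/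
theorem certSmall_exp_sq_le {x : ℝ} (hx : 40 ≤ x) : 10 ^ 9 / 3 * x ^ 2 ≤ Real.exp x := by
  have hx0 : 0 ≤ x := by linarith
  have h1 : x ^ 16 / (Nat.factorial 16 : ℝ) ≤ Real.exp x := Real.pow_div_factorial_le_exp x hx0 16
  have hfact : (Nat.factorial 16 : ℝ) = 20922789888000 := by norm_num [Nat.factorial]
  rw [hfact] at h1
  have h2 : (40 : ℝ) ^ 14 ≤ x ^ 14 := pow_le_pow_left₀ (by norm_num) hx 14
  have h3 : 10 ^ 9 / 3 * x ^ 2 ≤ x ^ 16 / 20922789888000 := by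
    rw [le_div_iff₀ (by norm_num)]
    have hx16 : x ^ 16 = x ^ 14 * x ^ 2 := by ring
    rw [hx16]
    nlinarith [h2, sq_nonneg x]
  exact h3.trans h1

/-- **Far region.** If `0 < T ≤ 10⁻⁵`, `(eᵘ − 1)² ≤ Q` and `Q > (1/25)²`, then
`(1/(6T²)) e^{4u} e^{−Q/4T} ≤ 1/20`: the far region lies below the area atom. [folklore] -/
theorem certSmall_far {T u Q : ℝ} (hT : 0 < T) (hT' : T ≤ 1 / 100000)
    (hQ1 : (Real.exp u - 1) ^ 2 ≤ Q) (hQ2 : (1 / 25 : ℝ) ^ 2 < Q) :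
    1 / (6 * T ^ 2) * Real.exp (4 * u) * Real.exp (-Q / (4 * T)) ≤ 1 / 20 := by
  have hr0 : 0 < Real.exp u := Real.exp_pos u
  have hTne : T ≠ 0 := hT.ne'
  have h4u : Real.exp (4 * u) = Real.exp u ^ 4 := by rw [← Real.exp_nat_mul]; norm_num
  rcases le_or_gt (Real.exp u) 2 with hle | hgt
  · -- `eᵘ ≤ 2`: `e^{4u} ≤ 16` and `e^{−Q/4T} ≤ e^{−x}`, `x = 1/(2500T) ≥ 40`
    set x : ℝ := 1 / (2500 * T) with hx
    have hx40 : 40 ≤ x := by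
      rw [hx, le_div_iff₀ (by positivity)]
      linarith
    have hex : 10 ^ 9 / 3 * x ^ 2 ≤ Real.exp x := certSmall_exp_sq_le hx40
    have h16 : Real.exp (4 * u) ≤ 16 := by
      rw [h4u]
      calc Real.exp u ^ 4 ≤ 2 ^ 4 := pow_le_pow_left₀ hr0.le hle 4
        _ = 16 := by norm_num
    have hE : Real.exp (-Q / (4 * T)) ≤ (Real.exp x)⁻¹ := by
      rw [← Real.exp_neg]
      apply Real.exp_le_exp.2
      have h1 : x * (4 * T) = (1 / 25) ^ 2 := by rw [hx]; field_simp; norm_num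
      rw [div_le_iff₀ (by positivity : (0 : ℝ) < 4 * T)]
      linarith
    have hkey : 160 / 3 ≤ T ^ 2 * Real.exp x := by
      have h1 : T ^ 2 * (10 ^ 9 / 3 * x ^ 2) = 160 / 3 := by rw [hx]; field_simp; norm_num
      rw [← h1]
      exact mul_le_mul_of_nonneg_left hex (sq_nonneg T)
    have hTe : 0 < T ^ 2 * Real.exp x := by positivity
    calc 1 / (6 * T ^ 2) * Real.exp (4 * u) * Real.exp (-Q / (4 * T))
        ≤ 1 / (6 * T ^ 2) * 16 * (Real.exp x)⁻¹ := by gcongr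
      _ = 8 / 3 / (T ^ 2 * Real.exp x) := by field_simp; ring
      _ ≤ 8 / 3 / (160 / 3) := by gcongr
      _ = 1 / 20 := by norm_num
  · -- `eᵘ > 2`: `Q ≥ e^{2u}/4`, `y = e^{2u}/(16T)`, `y³/6 ≤ eʸ`
    set r := Real.exp u with hr
    have hprod : 0 ≤ (r - 2) * (3 * r - 2) := mul_nonneg (by linarith) (by linarith)
    have hQr : r ^ 2 / 4 ≤ Q := by nlinarith [hprod, hQ1]
    set y : ℝ := r ^ 2 / (16 * T) with hy
    have hy0 : 0 ≤ y := by positivity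
    have hE : Real.exp (-Q / (4 * T)) ≤ Real.exp (-y) := by
      apply Real.exp_le_exp.2
      rw [hy, div_le_iff₀ (by positivity : (0 : ℝ) < 4 * T)]
      have h1 : r ^ 2 / (16 * T) * (4 * T) = r ^ 2 / 4 := by field_simp; ring
      linarith
    have hexp : y ^ 3 / 6 ≤ Real.exp y := by
      have h := Real.pow_div_factorial_le_exp y hy0 3
      norm_num [Nat.factorial] at h
      exact h
    have halg : 1 / (6 * T ^ 2) * r ^ 4 ≤ 1 / 20 * (y ^ 3 / 6) := by
      have e1 : 1 / 20 * (y ^ 3 / 6) = r ^ 6 / (491520 * T ^ 3) := by rw [hy]; field_simp; ring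
      have e2 : 1 / (6 * T ^ 2) * r ^ 4 = r ^ 4 / (6 * T ^ 2) := by ring
      rw [e1, e2, div_le_div_iff₀ (by positivity) (by positivity)]
      have h := mul_nonneg (mul_nonneg (pow_nonneg hT.le 2) (pow_nonneg hr0.le 4))
        (show (0 : ℝ) ≤ 6 * r ^ 2 - 491520 * T by nlinarith)
      nlinarith [h]
    calc 1 / (6 * T ^ 2) * Real.exp (4 * u) * Real.exp (-Q / (4 * T))
        ≤ 1 / (6 * T ^ 2) * r ^ 4 * Real.exp (-y) := by rw [h4u]; gcongr
      _ ≤ 1 / 20 * (y ^ 3 / 6) * Real.exp (-y) := by gcongr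
      _ ≤ 1 / 20 * Real.exp y * Real.exp (-y) := by gcongr
      _ = 1 / 20 := by rw [mul_assoc, ← Real.exp_add, add_neg_cancel, Real.exp_zero, mul_one]

/-- **Small-scale certificate** (`0 < T ≤ 10⁻⁵`, one zonal atom plus the area atom): with `σ = 0`,
`τ = (109/100) T`, `w = e^{4/25} (109/100)²`, `c = 1/20` (mass `≤ 147/100`) the broadened on-axis cylinder
kernel plus the area atom dominate the Jacobian-weighted pulled-back Euclidean Gaussian kernel times
`V = 8π²/3` on `ℝ × [−1,1]`.  Registered stub `stub_certSmall` of the line `conformal-kernel-domination`.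
[folklore] -/
theorem stub_certSmall :
    ∀ T : ℝ, 0 < T → T ≤ 1 / 100000 → ∃ σ τ w c : ℝ, 0 < τ ∧ 0 ≤ w ∧ 0 ≤ c ∧ w + c ≤ 147 / 100 ∧
      ∀ u s : ℝ, -1 ≤ s → s ≤ 1 →
        (8 * Real.pi ^ 2 / 3) * ((4 * Real.pi * T) ^ 2)⁻¹ * Real.exp (4 * u) *
            Real.exp (-(Real.exp (2 * u) - 2 * Real.exp u * s + 1) / (4 * T)) ≤
          w * (zonal τ s * Real.exp (-(u - σ) ^ 2 / (4 * τ))) + c := by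
  intro T hT hT'
  refine ⟨0, 109 / 100 * T, Real.exp (4 / 25) * (109 / 100) ^ 2, 1 / 20, by positivity, by positivity,
    by norm_num, certSmall_mass, fun u s hs1 hs2 => ?_⟩
  have hTne : T ≠ 0 := hT.ne'
  have hπ : Real.pi ≠ 0 := Real.pi_ne_zero
  set τ : ℝ := 109 / 100 * T with hτ
  have hτ0 : 0 < τ := by positivity
  -- the Euclidean defect `Q`
  set Q : ℝ := (Real.exp u - 1) ^ 2 + 2 * Real.exp u * (1 - s) with hQ
  have hQeq : Real.exp (2 * u) - 2 * Real.exp u * s + 1 = Q := by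
    have h2 : Real.exp (2 * u) = Real.exp u ^ 2 := by rw [← Real.exp_nat_mul]; norm_num
    rw [h2, hQ]; ring
  rw [hQeq]
  -- Cheeger–Yau at scale `τ`; positivity of the typed zonal kernel
  have hCY := CheegerYauZonalSphereFour_holds τ hτ0 s hs1 hs2
  have hZpos : 0 < zonal τ s := lt_of_lt_of_le (by positivity) hCY
  have hatom : 0 ≤ Real.exp (4 / 25) * (109 / 100) ^ 2 * (zonal τ s * Real.exp (-(u - 0) ^ 2 / (4 * τ))) :=
    mul_nonneg (by positivity) (mul_nonneg hZpos.le (Real.exp_pos _).le)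
  rcases le_or_gt Q ((1 / 25 : ℝ) ^ 2) with hnear | hfar
  · -- NEAR REGION
    have hcmp := near_exp_compare (ε := 1 / 25) (κ := 9 / 100) (u := u) (c := s) (a := 1 / (4 * T))
      (by norm_num) (by norm_num) (by norm_num) (by norm_num) hs1 hs2 hnear (by positivity)
    have h425 : (4 : ℝ) * (1 / 25) = 4 / 25 := by norm_num
    rw [h425] at hcmp
    have hsplit : Real.exp (-(1 / (4 * T) * ((Real.arccos s) ^ 2 + u ^ 2) / (1 + 9 / 100))) =
        Real.exp (-(Real.arccos s) ^ 2 / (4 * τ)) * Real.exp (-(u - 0) ^ 2 / (4 * τ)) := by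
      rw [← Real.exp_add]
      congr 1
      rw [hτ]
      field_simp
      ring
    have hpref : (8 * Real.pi ^ 2 / 3) * ((4 * Real.pi * T) ^ 2)⁻¹ =
        (109 / 100) ^ 2 * ((8 * Real.pi ^ 2 / 3) * ((4 * Real.pi * τ) ^ 2)⁻¹) := by
      rw [hτ]
      field_simp
    have hQa : -Q / (4 * T) = -(1 / (4 * T) * Q) := by ring
    calc (8 * Real.pi ^ 2 / 3) * ((4 * Real.pi * T) ^ 2)⁻¹ * Real.exp (4 * u) * Real.exp (-Q / (4 * T))
        = (8 * Real.pi ^ 2 / 3) * ((4 * Real.pi * T) ^ 2)⁻¹ *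
            (Real.exp (4 * u) * Real.exp (-(1 / (4 * T) * Q))) := by
          rw [hQa]; ring
      _ ≤ (8 * Real.pi ^ 2 / 3) * ((4 * Real.pi * T) ^ 2)⁻¹ *
            (Real.exp (4 / 25) *
              Real.exp (-(1 / (4 * T) * ((Real.arccos s) ^ 2 + u ^ 2) / (1 + 9 / 100)))) :=
          mul_le_mul_of_nonneg_left hcmp (by positivity)
      _ = Real.exp (4 / 25) * (109 / 100) ^ 2 *
            (((8 * Real.pi ^ 2 / 3) * ((4 * Real.pi * τ) ^ 2)⁻¹ *
                Real.exp (-(Real.arccos s) ^ 2 / (4 * τ))) *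
              Real.exp (-(u - 0) ^ 2 / (4 * τ))) := by
          rw [hsplit, hpref]; ring
      _ ≤ Real.exp (4 / 25) * (109 / 100) ^ 2 * (zonal τ s * Real.exp (-(u - 0) ^ 2 / (4 * τ))) := by
          gcongr
      _ ≤ Real.exp (4 / 25) * (109 / 100) ^ 2 * (zonal τ s * Real.exp (-(u - 0) ^ 2 / (4 * τ))) +
            1 / 20 := by
          linarith
  · -- FAR REGION
    have hpre : (8 * Real.pi ^ 2 / 3) * ((4 * Real.pi * T) ^ 2)⁻¹ = 1 / (6 * T ^ 2) := by
      field_simp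
      ring
    have hQ1 : (Real.exp u - 1) ^ 2 ≤ Q := by
      have h := mul_nonneg (mul_nonneg (zero_le_two (α := ℝ)) (Real.exp_pos u).le) (sub_nonneg.2 hs2)
      rw [hQ]
      linarith
    have hfarb := certSmall_far hT hT' hQ1 hfar
    rw [hpre]
    linarith

end Summit.SmoothPoincare4.SmoothPoincare4.Theorems.CylinderEntropySliceIsolation

end
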